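import Mathlib.Analysis.SpecialFunctions.Complex.LogDeriv
import Mathlib.Analysis.Real.Pi.Bounds
import Mathlib.FieldTheory.KrullTopology
import Literature.NumberTheory.Automorphic.LocalConstants
import Literature.NumberTheory.GaloisRepresentations.LocalGaloisGroupProofs
import HarnessLib

/-!
# Discharged fact: continuous characters of `W_F` are trivial on an open subgroup of `I_F`

`Literature.NumberTheory.Automorphic.LocalConstants` records as a named fact
(`Literature.NumberTheory.GaloisRepresentations.WeilGroup.exists_subgroup_le_inertia_isOpen_of_continuous`,
D-0014) the statement: for a non-archimedean local field `F`, every continuous character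
`χ : W_F →ₜ* ℂˣ` of the Weil group (Weil topology of
`Literature.NumberTheory.GaloisRepresentations.WeilGroup.instTopologicalSpace`) is trivial on
some subgroup `U ≤ I_F` which is open in `W_F`.  This file proves it
(`WeilGroup.exists_subgroup_le_inertia_isOpen_of_continuous_holds`), so users holding
`(hns : WeilGroup.exists_subgroup_le_inertia_isOpen_of_continuous)` (`WeilDeligneRep.ofQuasiChar`,
`LocalEpsilonSystem.dim_one`, `IsLocalLanglandsGL`, …) can discharge the hypothesis.

Source.  Tate, *Number theoretic background* (Corvallis 1979), (1.4.1) (the topology of `W_F`: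
`I_F` is open and carries the profinite Krull topology) and (2.2) (representations of `W_F`;
a homomorphism into `GL_n(ℂ)` is continuous iff its kernel contains an open subgroup of `I_F`,
because `GL_n(ℂ)` has no small subgroups); Deligne, *Les constantes des équations
fonctionnelles des fonctions `L`* (Antwerp II, 1973), §8.3; cf. Cogdell, *Dual groups and
Langlands functoriality*, in Gelbart–de Shalit (eds.), *An Introduction to the Langlands
Program*, §2 ("whose kernel contains an open subgroup of `I`, that is, which is continuous").

## Proof

* `Literature.NumberTheory.Automorphic.unitsComplex_noSmallSubgroups`: **`ℂˣ` has no small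
  subgroups** — the open neighbourhood `N = exp(B(0,1))` of `1` contains no non-trivial
  subgroup, indeed no `z ≠ 1` all of whose positive powers lie in `N`: if `z = exp w` with
  `0 < ‖w‖ < 1`, the integer `n = ⌈1/‖w‖⌉` has `1 ≤ n‖w‖ < 2`, and `zⁿ = exp(nw) = exp(w')` with
  `‖w'‖ < 1` forces `nw - w' ∈ 2πiℤ` with `‖nw - w'‖ < 3 < 2π`, so `nw = w'`, contradicting
  `‖w'‖ < 1 ≤ ‖nw‖` (`Complex.isOpenMap_exp`, `Complex.exp_eq_exp_iff_exists_int`,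
  `Real.pi_gt_three`).
* `Literature.NumberTheory.GaloisRepresentations.WeilGroup.exists_isOpen_subset_of_isOpen`: in
  the Weil topology (generated by the sets `{y | y w⁻¹ ∈ I_F, y ∈ V}`, `V ⊆ Γ_F` Krull-open) every
  open `s ∋ x` contains such a set with `w = x` (induction on `TopologicalSpace.GenerateOpen`;
  right cosets of `I_F` need no normality).
* `Literature.NumberTheory.GaloisRepresentations.WeilGroup.isOpen_inertia_inf_comap`: for an open
  subgroup `H ≤ Γ_F`, `I_F ⊓ H` is an open subgroup of `W_F` (it is a generating set, `w = 1`).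
* The discharge: `χ⁻¹(N)` is an open neighbourhood of `1`, so contains `{y ∈ I_F | y ∈ V}` for a
  Krull-open `V ∋ 1`; `V ⊇ Gal(F̄/E)` for a finite `E/F` (`krullTopology_mem_nhds_one_iff`), and
  `U = I_F ⊓ Gal(F̄/E)` is an open subgroup of `W_F` inside `I_F` with `χ(U) ⊆ N`; as `χ(U)`
  is closed under powers, `χ = 1` on `U`.

## Mathlib

USED: `Complex.isOpenMap_exp`, `Complex.exp_eq_exp_iff_exists_int`, `Complex.exp_nat_mul`,
`Real.pi_gt_three`, `Nat.le_ceil`, `Nat.ceil_lt_add_one`, `Units.continuous_val`,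
`krullTopology_mem_nhds_one_iff`, `IntermediateField.fixingSubgroup_isOpen`,
`TopologicalSpace.isOpen_generateFrom_of_mem`, `TopologicalSpace.GenerateOpen` (induction).
Mathlib has no "no small subgroups" notion at this pin (`rg -i 'small.?subgroup'` is empty).

## Part II — Discharged fact: independence of the Frobenius (`WeilDeligneRep.frobDetFactor_eq`)

`LocalConstants.lean` also records as a named fact `WeilDeligneRep.frobDetFactor_eq` (Tate,
*Number theoretic background*, Corvallis 1979, (4.1.6); Deligne, Antwerp II (1973), §8.12,
(8.12.1)): the factor `det(-Φ q^{-s} | V^{I_F} ⧸ (ker N)^{I_F})` of the `ε`-factor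
`ε((ρ, N), s, ψ, dx) = ε₀(ρ ⊗ ω_s, ψ, dx) · det(-Φ q^{-s} | V^{I_F} ⧸ (ker N)^{I_F})` of a
Weil–Deligne representation `(ρ, N)`, computed there (`WeilDeligneRep.frobDetFactor`) with the
chosen geometric Frobenius `geomFrob F hex`, is the same for every geometric Frobenius `Φ`
(`deg Φ = -1`).  Tate (4.1.6) writes the determinant for an arbitrary `Φ ∈ W_F` inducing the
inverse Frobenius on the residue field, i.e. for the coset `Φ I_F`; the independence is the
remark that `I = I_F` acts trivially on `V^I`, hence on `V^I ⧸ V_N^I`.  Part II proves it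
(`WeilDeligneRep.frobDetFactor_eq_holds`, last section of this file):

* `WeilDeligneRep.inertiaQuotEnd_eq_of_inv_mul_mem_inertia` — the action `inertiaQuotEnd r w` of
  `w ∈ W_F` on `V^{I_F} ⧸ (ker N)^{I_F}` only depends on the coset `w I_F`, because the
  `W_F`-representation `Representation.toInvariants ρ I_F` on `V^{I_F}` (Mathlib) is trivial on
  `I_F` (Mathlib `Representation.apply_eq_of_coe_eq`); in particular it is `1` on `I_F`
  (`inertiaQuotEnd_eq_one_of_mem_inertia`) and multiplicative (`inertiaQuotEnd_mul`, Mathlib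
  `Submodule.mapQ_comp`).
* `WeilDeligneRep.inertiaQuotEnd_eq_of_deg_eq` — two elements of `W_F` of the same degree differ
  by inertia: `deg` is a homomorphism with kernel `I_F` (`WeilGroup.deg_mul`, `deg_inv`,
  `deg_eq_zero_iff_mem_inertia`; Tate (1.4.1)), unconditionally since the `LocalGaloisGroup`
  facts `IsFrobPow.mul`, `IsFrobPow.unique` these lemmas take are discharged
  (`IsFrobPow.mul_holds`, `IsFrobPow.unique_holds` of `LocalGaloisGroupProofs.lean`, imported for
  this purpose); so `inertiaQuotEnd r w` only depends on `deg w`.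
* `WeilDeligneRep.frobDetFactor_eq_holds` — `deg (geomFrob F hex) = -1 = deg Φ`
  (`WeilDeligneRep.deg_geomFrob`).

This parallels the discharge `WeilDeligneRep.eulerFactor_eq_holds` of
`Literature/NumberTheory/GaloisRepresentations/WeilDeligneRepProofs.lean` (the same remark for
`(ker N)^{I_F}` in place of `V^{I_F} ⧸ (ker N)^{I_F}`).  Sources for Part II: J. Tate, *Number
theoretic background*, Proc. Sympos. Pure Math. XXXIII (Corvallis 1977), Part 2, AMS 1979,
3–26, (1.4.1), (4.1.6) — keys `TateCorvallis1979` / `Corvallis1979`, doi:10.1090/pspum/033.2/546607,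
not held by the literature store at the time of writing (acquisition requested); P. Deligne,
*Les constantes des équations fonctionnelles des fonctions L*, Antwerp II, LNM 349 (1973),
§8.12, (8.12.1) — key `DeligneAntwerpII1973`.  Part II introduces no definition, instance or
attribute and restates nothing of `LocalConstants.lean`; it only adds theorems.

## Part III — Continuity of representations of `W_F` and finite extensions

`WeilGroup.isContinuousRep_iff_exists_intermediateField`: a representation `ρ` of `W_F` on a
discrete space is continuous (`WeilGroup.IsContinuousRep`: trivial on an open subgroup of `I_F`)
iff it is trivial on `I_F ⊓ Gal(F̄/L)` for some finite subextension `L ⊆ F̄` of `F` (Tate (1.4.1),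
(2.2)); from `exists_isOpen_subset_of_isOpen`, `isOpen_inertia_inf_comap` and Mathlib's
`krullTopology_mem_nhds_one_iff`.  First step of the structure of continuous representations of
`W_F` used in the uniqueness of local constants (Deligne 1973, Thm. 4.1;
`Literature.NumberTheory.Automorphic.LocalConstantsUniqueness`).
-/

noncomputable section

open Complex Metric

namespace Literature.NumberTheory.Automorphic

/-! ### `ℂˣ` has no small subgroups -/

/-- **No small subgroups in `ℂˣ`.**  There is an open neighbourhood `N` of `1` in `ℂˣ` such
that the only `z ∈ ℂˣ` all of whose powers `zⁿ` (`n ∈ ℕ`) lie in `N` is `z = 1`; in particular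
`N` contains no subgroup other than `{1}`.  (Take `N = exp(B(0,1))`.)
Ref: Tate, Corvallis 1979, (2.2); Montgomery–Zippin, *Topological transformation groups*, §2.
[folklore] -/
theorem unitsComplex_noSmallSubgroups :
    ∃ N : Set ℂˣ, IsOpen N ∧ (1 : ℂˣ) ∈ N ∧ ∀ z : ℂˣ, (∀ n : ℕ, z ^ n ∈ N) → z = 1 := by
  refine ⟨((↑) : ℂˣ → ℂ) ⁻¹' (exp '' ball (0 : ℂ) 1), ?_, ?_, ?_⟩
  · exact (Complex.isOpenMap_exp _ isOpen_ball).preimage Units.continuous_val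
  · exact ⟨0, mem_ball_self one_pos, by simp⟩
  · intro z hz
    obtain ⟨w, hw, hwz⟩ := hz 1
    rw [Units.val_pow_eq_pow_val, pow_one] at hwz
    rw [mem_ball_zero_iff] at hw
    by_cases hw0 : w = 0
    · subst hw0
      ext
      rw [← hwz, Complex.exp_zero, Units.val_one]
    exfalso
    have hpos : 0 < ‖w‖ := norm_pos_iff.mpr hw0
    obtain ⟨w', hw', hw'z⟩ := hz ⌈‖w‖⁻¹⌉₊
    rw [mem_ball_zero_iff] at hw'
    set n : ℕ := ⌈‖w‖⁻¹⌉₊ with hn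
    have hn1 : 1 ≤ (n : ℝ) * ‖w‖ := by
      calc (1 : ℝ) = ‖w‖⁻¹ * ‖w‖ := by field_simp
        _ ≤ n * ‖w‖ := by gcongr; exact Nat.le_ceil _
    have hn2 : (n : ℝ) * ‖w‖ < 2 := by
      have h := Nat.ceil_lt_add_one (inv_nonneg.mpr hpos.le)
      calc (n : ℝ) * ‖w‖ < (‖w‖⁻¹ + 1) * ‖w‖ := by gcongr
        _ = 1 + ‖w‖ := by field_simp
        _ < 2 := by linarith
    have key : exp (n * w) = exp w' := by
      rw [Complex.exp_nat_mul, hw'z, Units.val_pow_eq_pow_val, ← hwz]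
    obtain ⟨k, hk⟩ := Complex.exp_eq_exp_iff_exists_int.mp key
    have hlt : ‖(n : ℂ) * w - w'‖ < 3 := by
      calc ‖(n : ℂ) * w - w'‖ ≤ ‖(n : ℂ) * w‖ + ‖w'‖ := norm_sub_le _ _
        _ < 2 + 1 := by
          rw [norm_mul, Complex.norm_natCast]
          exact add_lt_add hn2 hw'
        _ = 3 := by norm_num
    rcases eq_or_ne k 0 with rfl | hk0
    · rw [Int.cast_zero, zero_mul, add_zero] at hk
      have h := congrArg (‖·‖) hk
      simp only [norm_mul, Complex.norm_natCast] at h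
      linarith
    · have hge : (3 : ℝ) < ‖(n : ℂ) * w - w'‖ := by
        rw [hk, add_sub_cancel_left, norm_mul, norm_mul, norm_mul, Complex.norm_intCast,
          Complex.norm_I, Complex.norm_real, Real.norm_of_nonneg Real.pi_pos.le, Complex.norm_two,
          mul_one]
        have h1 : (1 : ℝ) ≤ |(k : ℝ)| := by
          rw [← Int.cast_abs]; exact_mod_cast Int.one_le_abs hk0
        nlinarith [Real.pi_gt_three]
      linarith

end Literature.NumberTheory.Automorphic

/-! ### Local structure of the Weil topology -/

namespace Literature.NumberTheory.GaloisRepresentations.WeilGroup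

open Field

variable {F : Type*} [Field F] [ValuativeRel F] [TopologicalSpace F] [IsNonarchimedeanLocalField F]

/-- **Local structure of the Weil topology.**  Every Weil-open `s ⊆ W_F` contains, around each
of its points `x`, a generating open set `{y | y x⁻¹ ∈ I_F ∧ y|_{F̄} ∈ V}` with `V ⊆ Gal(F̄/F)`
Krull-open (the generating family of `WeilGroup.instTopologicalSpace` is stable under the
operations of `TopologicalSpace.GenerateOpen` in this sense; right cosets `I_F x` are used, so
no normality of `I_F` is needed).
Ref: Tate, *Number theoretic background* (Corvallis 1979), (1.4.1). [cite: Corvallis1979, (1.4.1)] -/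
theorem exists_isOpen_subset_of_isOpen {s : Set (WeilGroup F)} (hs : IsOpen s) :
    ∀ x ∈ s, ∃ V : Set (absoluteGaloisGroup F), IsOpen V ∧ toAbsGalois F x ∈ V ∧
      {y | y * x⁻¹ ∈ inertia F ∧ toAbsGalois F y ∈ V} ⊆ s := by
  have hs' : TopologicalSpace.GenerateOpen
      {U | ∃ (w : WeilGroup F) (V : Set (absoluteGaloisGroup F)),
        IsOpen V ∧ U = {x | x * w⁻¹ ∈ inertia F ∧ toAbsGalois F x ∈ V}} s := hs
  clear hs
  induction hs' with
  | basic u hu =>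
    obtain ⟨w, V, hV, rfl⟩ := hu
    intro x hx
    refine ⟨V, hV, hx.2, fun y hy => ⟨?_, hy.2⟩⟩
    have h : y * w⁻¹ = (y * x⁻¹) * (x * w⁻¹) := by group
    rw [h]
    exact mul_mem hy.1 hx.1
  | univ => exact fun x _ => ⟨Set.univ, isOpen_univ, Set.mem_univ _, Set.subset_univ _⟩
  | inter u v _ _ ihu ihv =>
    intro x hx
    obtain ⟨V₁, hV₁, hx₁, h₁⟩ := ihu x hx.1
    obtain ⟨V₂, hV₂, hx₂, h₂⟩ := ihv x hx.2
    exact ⟨V₁ ∩ V₂, hV₁.inter hV₂, ⟨hx₁, hx₂⟩,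
      fun y hy => ⟨h₁ ⟨hy.1, hy.2.1⟩, h₂ ⟨hy.1, hy.2.2⟩⟩⟩
  | sUnion S _ ih =>
    intro x hx
    obtain ⟨u, hu, hxu⟩ := Set.mem_sUnion.mp hx
    obtain ⟨V, hV, hxV, h⟩ := ih u hu x hxu
    exact ⟨V, hV, hxV, h.trans (Set.subset_sUnion_of_mem hu)⟩

/-- For a Krull-open subgroup `H ≤ Gal(F̄/F)`, the subgroup `I_F ⊓ H` (pulled back along
`W_F → Gal(F̄/F)`) is open in the Weil topology: it is the generating open set with `w = 1`,
`V = H`.  Ref: Tate, *Number theoretic background* (Corvallis 1979), (1.4.1). [cite: Corvallis1979, (1.4.1)] -/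
theorem isOpen_inertia_inf_comap {H : Subgroup (absoluteGaloisGroup F)}
    (hH : IsOpen (H : Set (absoluteGaloisGroup F))) :
    IsOpen ((inertia F ⊓ H.comap (toAbsGalois F) : Subgroup (WeilGroup F)) : Set (WeilGroup F)) := by
  refine TopologicalSpace.isOpen_generateFrom_of_mem ⟨1, H, hH, ?_⟩
  ext x
  simp [Subgroup.coe_inf]

/-- **Discharge** of the named fact
`WeilGroup.exists_subgroup_le_inertia_isOpen_of_continuous` (no small subgroups): every
continuous character `χ : W_F →ₜ* ℂˣ` is trivial on an open subgroup `U ≤ I_F` of `W_F`.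
Proof: `χ⁻¹(N)`, `N = exp(B(0,1)) ⊆ ℂˣ`, is an open neighbourhood of `1`, hence contains
`I_F ⊓ Gal(F̄/E)` for some finite `E/F` (`exists_isOpen_subset_of_isOpen`,
`krullTopology_mem_nhds_one_iff`); this subgroup is open (`isOpen_inertia_inf_comap`) and its
image is a subset of `N` closed under powers, hence trivial
(`unitsComplex_noSmallSubgroups`).
Ref: Tate, *Number theoretic background* (Corvallis 1979), (1.4.1), (2.2); Deligne, Antwerp II
(1973), §8.3. [cite: Corvallis1979, (2.2)] -/
theorem exists_subgroup_le_inertia_isOpen_of_continuous_holds :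
    exists_subgroup_le_inertia_isOpen_of_continuous (F := F) := by
  intro χ
  obtain ⟨N, hNo, h1N, hN⟩ := Automorphic.unitsComplex_noSmallSubgroups
  have hs : IsOpen (χ ⁻¹' N) := hNo.preimage (map_continuous χ)
  have h1 : (1 : WeilGroup F) ∈ χ ⁻¹' N := by
    rw [Set.mem_preimage, map_one]
    exact h1N
  obtain ⟨V, hVo, h1V, hV⟩ := exists_isOpen_subset_of_isOpen hs 1 h1
  rw [map_one] at h1V
  obtain ⟨E, _, hE⟩ :=
    (krullTopology_mem_nhds_one_iff F (AlgebraicClosure F) V).mp (hVo.mem_nhds h1V)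
  refine ⟨inertia F ⊓ E.fixingSubgroup.comap (toAbsGalois F), inf_le_left,
    isOpen_inertia_inf_comap E.fixingSubgroup_isOpen, fun u hu => hN _ fun n => ?_⟩
  have hun : u ^ n ∈ inertia F ⊓ E.fixingSubgroup.comap (toAbsGalois F) := pow_mem hu n
  have h : u ^ n ∈ χ ⁻¹' N := hV ⟨by simpa using hun.1, hE hun.2⟩
  simpa [map_pow] using h

end Literature.NumberTheory.GaloisRepresentations.WeilGroup

/-! ## Part II — Independence of the Frobenius in `det(-Φ q^{-s} | V^{I_F} ⧸ (ker N)^{I_F})` -/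

namespace Literature.NumberTheory.GaloisRepresentations.WeilDeligneRep

open IsNonarchimedeanLocalField WeilGroup

variable {F : Type*} [Field F] [ValuativeRel F] [TopologicalSpace F] [IsNonarchimedeanLocalField F]

/-! ### The action on `V^{I_F} ⧸ (ker N)^{I_F}` factors through `W_F ⧸ I_F` -/

section General

variable {C : Type*} [Field C] [CharZero C] {V : Type*} [AddCommGroup V] [Module C V]

/-- The action of `w ∈ W_F` on `V^{I_F} ⧸ (ker N)^{I_F}` only depends on the coset `w I_F`:
if `w⁻¹ w' ∈ I_F` then `inertiaQuotEnd r w = inertiaQuotEnd r w'` (inertia acts trivially on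
`V^{I_F}`: Mathlib `Representation.apply_eq_of_coe_eq` for `Representation.toInvariants ρ I_F`,
which is trivial on `I_F`).
Ref: Tate, *Number theoretic background* (Corvallis 1979), (4.1.6). [cite: TateCorvallis1979, (4.1.6)] -/
theorem inertiaQuotEnd_eq_of_inv_mul_mem_inertia
    (hn : absInertia_normal F) (r : WeilDeligneRep F C V) {w w' : WeilGroup F}
    (h : w⁻¹ * w' ∈ inertia F) : r.inertiaQuotEnd hn w = r.inertiaQuotEnd hn w' := by
  haveI := inertia_normal hn
  have key : r.ρ.toInvariants (inertia F) w = r.ρ.toInvariants (inertia F) w' :=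
    Representation.apply_eq_of_coe_eq _ (inertia F) w w' (QuotientGroup.eq.mpr h)
  unfold inertiaQuotEnd
  simp only [key]

/-- On `V^{I_F} ⧸ (ker N)^{I_F}` the action of `w ∈ W_F` only depends on `deg w`: if
`deg w = deg w'` then `deg (w⁻¹ w') = 0`, i.e. `w⁻¹ w' ∈ I_F` (exactness of `1 → I_F → W_F → ℤ`,
`WeilGroup.deg_eq_zero_iff_mem_inertia`), which acts trivially.  In particular all geometric
Frobenii `Φ` (`deg Φ = -1`) induce the same endomorphism of `V^{I_F} ⧸ (ker N)^{I_F}`.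
Ref: Tate, *Number theoretic background* (Corvallis 1979), (1.4.1), (4.1.6). [cite: TateCorvallis1979, (4.1.6)] -/
theorem inertiaQuotEnd_eq_of_deg_eq
    (hn : absInertia_normal F) (r : WeilDeligneRep F C V) {w w' : WeilGroup F}
    (h : deg w = deg w') : r.inertiaQuotEnd hn w = r.inertiaQuotEnd hn w' := by
  refine r.inertiaQuotEnd_eq_of_inv_mul_mem_inertia hn ?_
  rw [← deg_eq_zero_iff_mem_inertia IsFrobPow.mul_holds IsFrobPow.unique_holds,
    deg_mul IsFrobPow.mul_holds IsFrobPow.unique_holds,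
    deg_inv IsFrobPow.mul_holds IsFrobPow.unique_holds, h, neg_add_cancel]

/-- Inertia acts trivially on `V^{I_F} ⧸ (ker N)^{I_F}`: `inertiaQuotEnd r u = 1` for `u ∈ I_F`.
Ref: Tate, *Number theoretic background* (Corvallis 1979), (4.1.6). [cite: TateCorvallis1979, (4.1.6)] -/
theorem inertiaQuotEnd_eq_one_of_mem_inertia
    (hn : absInertia_normal F) (r : WeilDeligneRep F C V) {u : WeilGroup F} (hu : u ∈ inertia F) :
    r.inertiaQuotEnd hn u = 1 := by
  rw [r.inertiaQuotEnd_eq_of_inv_mul_mem_inertia hn (w := u) (w' := 1) (by simpa using hu)]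
  haveI := inertia_normal hn
  simp only [inertiaQuotEnd, map_one, Module.End.one_eq_id]
  exact Submodule.mapQ_id _

/-- The action on `V^{I_F} ⧸ (ker N)^{I_F}` is multiplicative:
`inertiaQuotEnd r (w w') = inertiaQuotEnd r w * inertiaQuotEnd r w'` (`Representation.toInvariants`
is a homomorphism and `Submodule.mapQ` is functorial, Mathlib `Submodule.mapQ_comp`).
Ref: Tate, *Number theoretic background* (Corvallis 1979), (4.1.6). [cite: TateCorvallis1979, (4.1.6)] -/
theorem inertiaQuotEnd_mul
    (hn : absInertia_normal F) (r : WeilDeligneRep F C V) (w w' : WeilGroup F) :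
    r.inertiaQuotEnd hn (w * w') = r.inertiaQuotEnd hn w * r.inertiaQuotEnd hn w' := by
  haveI := inertia_normal hn
  simp only [inertiaQuotEnd, map_mul, Module.End.mul_eq_comp]
  exact Submodule.mapQ_comp _ _ _ _ _ _ _

end General

/-! ### Independence of the Frobenius -/

section Complex

variable {V : Type*} [AddCommGroup V] [Module ℂ V]

/-- **Independence of the Frobenius** (discharge of the named fact
`WeilDeligneRep.frobDetFactor_eq`): for every geometric Frobenius `Φ` (`deg Φ = -1`),
`frobDetFactor r hn hex s = det(-q^{-s} Φ | V^{I_F} ⧸ (ker N)^{I_F})`.  Proof: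
`deg (geomFrob F hex) = -1 = deg Φ` (`WeilDeligneRep.deg_geomFrob`), and the action on
`V^{I_F} ⧸ (ker N)^{I_F}` only depends on the degree (`inertiaQuotEnd_eq_of_deg_eq`: two
geometric Frobenii differ by inertia, which acts trivially on `V^{I_F}`).
Ref: Tate, *Number theoretic background* (Corvallis 1979), (4.1.6); Deligne, Antwerp II (1973),
§8.12, (8.12.1). [cite: TateCorvallis1979, (4.1.6)] [cite: DeligneAntwerpII1973, §8.12] -/
theorem frobDetFactor_eq_holds :
    frobDetFactor_eq (F := F) (V := V) := by
  intro hn hex r s Φ hΦ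
  unfold frobDetFactor
  rw [r.inertiaQuotEnd_eq_of_deg_eq hn
    ((deg_geomFrob IsFrobPow.mul_holds IsFrobPow.unique_holds hex).trans hΦ.symm)]

end Complex

end Literature.NumberTheory.GaloisRepresentations.WeilDeligneRep

/-! ## Part III — Continuity of representations of `W_F` and finite extensions of `F` -/

namespace Literature.NumberTheory.GaloisRepresentations.WeilGroup

open Field

variable {F : Type*} [Field F] [ValuativeRel F] [TopologicalSpace F] [IsNonarchimedeanLocalField F]
  {C V : Type*} [CommSemiring C] [AddCommMonoid V] [Module C V]

/-- **A continuous representation of `W_F` is trivial on `I_F ∩ Gal(F̄/L)` for a finite `L/F`.**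
If `ρ` is trivial on an open subgroup `U ≤ I_F` of `W_F` (`IsContinuousRep ρ`), then there is a
finite subextension `L ⊆ F̄` of `F` such that `ρ` is trivial on the inertia elements acting
trivially on `L`, i.e. on `I_F ⊓ Gal(F̄/L)` (pulled back to `W_F`): `U ∋ 1` contains a basic open
set `{y ∈ I_F | y|_{F̄} ∈ V}` with `V` Krull-open (`exists_isOpen_subset_of_isOpen`), and `V`
contains `Gal(F̄/L)` for a finite `L` (Mathlib `krullTopology_mem_nhds_one_iff`).  This is the
first step of the structure theory of continuous representations of `W_F` (they are
representations of `W_F / (I_F ∩ Gal(F̄/L))`, an extension of `Gal` of a finite extension by `ℤ`).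
Ref: Tate, *Number theoretic background* (Corvallis 1979), (1.4.1), (2.2); Deligne, Antwerp II
(1973), §4.10, §8.3. [cite: Corvallis1979, (2.2)] -/
theorem IsContinuousRep.exists_intermediateField {ρ : Representation C (WeilGroup F) V}
    (hρ : IsContinuousRep ρ) :
    ∃ L : IntermediateField F (AlgebraicClosure F), FiniteDimensional F L ∧
      ∀ u ∈ inertia F ⊓ L.fixingSubgroup.comap (toAbsGalois F), ρ u = 1 := by
  obtain ⟨U, -, hUo, hU⟩ := hρ
  obtain ⟨W, hWo, h1W, hW⟩ := exists_isOpen_subset_of_isOpen hUo 1 U.one_mem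
  rw [map_one] at h1W
  obtain ⟨L, hL, hLW⟩ :=
    (krullTopology_mem_nhds_one_iff F (AlgebraicClosure F) W).mp (hWo.mem_nhds h1W)
  exact ⟨L, hL, fun u hu => hU u (hW ⟨by simpa using hu.1, hLW hu.2⟩)⟩

/-- Conversely, a representation of `W_F` trivial on `I_F ⊓ Gal(F̄/L)` for a finite `L/F` is
continuous: that subgroup is open in the Weil topology (`isOpen_inertia_inf_comap`, Mathlib
`IntermediateField.fixingSubgroup_isOpen`).
Ref: Tate, *Number theoretic background* (Corvallis 1979), (1.4.1), (2.2). [cite: Corvallis1979, (2.2)] -/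
theorem isContinuousRep_of_forall_mem_eq_one {ρ : Representation C (WeilGroup F) V}
    (L : IntermediateField F (AlgebraicClosure F)) [FiniteDimensional F L]
    (h : ∀ u ∈ inertia F ⊓ L.fixingSubgroup.comap (toAbsGalois F), ρ u = 1) :
    IsContinuousRep ρ :=
  ⟨inertia F ⊓ L.fixingSubgroup.comap (toAbsGalois F), inf_le_left,
    isOpen_inertia_inf_comap L.fixingSubgroup_isOpen, h⟩

/-- **Continuity of a representation of `W_F` on a discrete space, in terms of finite extensions**:
`ρ` is trivial on an open subgroup of `I_F` iff it is trivial on `I_F ∩ Gal(F̄/L)` for some finite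
subextension `L ⊆ F̄` of `F` (Tate: a homomorphism of `W_F` into `GL_n(ℂ)` is continuous iff its
kernel contains an open subgroup of `I_F`; the open subgroups `Gal(F̄/L)`, `L/F` finite, form a
basis of neighbourhoods of `1` in `Gal(F̄/F)`).
Ref: Tate, *Number theoretic background* (Corvallis 1979), (1.4.1), (2.2). [cite: Corvallis1979, (2.2)] -/
theorem isContinuousRep_iff_exists_intermediateField {ρ : Representation C (WeilGroup F) V} :
    IsContinuousRep ρ ↔ ∃ L : IntermediateField F (AlgebraicClosure F), FiniteDimensional F L ∧
      ∀ u ∈ inertia F ⊓ L.fixingSubgroup.comap (toAbsGalois F), ρ u = 1 :=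
  ⟨IsContinuousRep.exists_intermediateField, fun ⟨L, hL, h⟩ => by
    haveI := hL
    exact isContinuousRep_of_forall_mem_eq_one L h⟩

end Literature.NumberTheory.GaloisRepresentations.WeilGroup
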